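import Literature.Computability.Cryptography.LWEPrimePowerProgTop
import Literature.Computability.Cryptography.LWEPrimePowerProgQueryBridge
import Literature.Computability.Cryptography.LWEPrimePowerProgOutBridge
import Literature.Computability.Cryptography.LWEPrimePowerKernel
import Literature.Computability.Cryptography.LWEPrimePowerPolyBounds
import Literature.Computability.Cryptography.LWEPrimePowerFailure
import Literature.Computability.Complexity.AdaptiveFunctions
import Literature.Computability.Complexity.OracleSubroutineRand
import Literature.Computability.Complexity.CountingHierarchyProofs
import HarnessLib

/-!
# The Micciancio–Peikert machine, VIII′–X: the string functions on genuine inputs, the run against the simulated distinguisher, and hypothesis `h₂` of pqc.S21 as ONE oracle machine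

This file has three parts (formerly planned as `ProgTopBridge` / `MachineRun` / `Machine`), each with
its own module docstring below.

## Part VIII′: the machine's string functions on genuine inputs

Topic `Computability/Cryptography` (LWE), grouping namespace `LWE.MP12.Prog`, bridge between
`LWEPrimePowerProgTop.lean` (`topQ`, `topG`) and the strategy on the layout of the genuine input at
security parameter `n`. Proved material (no named fact) towards
`Literature.Computability.Cryptography.blprs_gapSVP_sqrt_dim_to_lwe_classical` (**pqc.S21**),
hypothesis `h₂`: with the schedule `prmOf c m₂ coinsD n` (`prmOf_eq_Pof`) and enough coins,
**`topQ_eq`** — the query of round `|answers| < nCalls` is `⟨1ⁿ, code of the strategy's query block⟩`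
with the strategy's coin slice cut to the distinguisher's tape — and **`topG_eq`** — the output is the
code of the secret `outOf (1/invGap) (topSolve e) (layout (S, coins)) answers` (`pairE_secret_eq`).

## References

* D. Micciancio, C. Peikert, *Trapdoors for lattices: simpler, tighter, faster, smaller*, EUROCRYPT 2012,
  LNCS 7237; full version IACR ePrint 2011/501, §3, Thm. 3.1 proof (pp. 15–16). [MicciancioPeikert2012]
-/

noncomputable section

namespace Literature.Computability.Cryptography

namespace LWE

namespace MP12

namespace Prog

open _root_.Computability Polynomial Literature.Computability.Complexity Literature.Computability.Complexity.CodeFP Finset BLPRS2013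

section Genuine

variable (c : ℕ) (m₂ : ℕ → ℕ) (coinsD : Polynomial ℕ) (n : ℕ)

/-- The coins per call of the schedule. [folklore] -/
abbrev ellOf : ℕ := coinsD.eval (2 * n + 2 + ldataBound (dim n) (2 ^ lev n) (m₂ n))

/-- **The schedule is the genuine parameter tuple** `Pof d e K' m N T N' m' ℓ G` with
`d = dim n`, `e = lev n`, `K' = aggK n - 1`, `m = m₂ n`, `N = reps c n`, `T = trials c n`, `N' = meas c n`,
`m' = extra n`, `G = invGap c n`. [folklore] -/
theorem prmOf_eq_Pof : (prmOf c m₂ coinsD n : PrmT) =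
    Pof (dim n) (lev n) (aggK n - 1) (m₂ n) (reps c n) (trials c n) (meas c n) (extra n) (ellOf m₂ coinsD n) (invGap c n) := by
  have hK : aggK n - 1 + 1 = logSucc n ^ 4 := by
    have h1 := one_le_aggK n
    have h2 : aggK n = logSucc n ^ 4 := by simp only [aggK, logK, logSucc_eq]
    omega
  simp only [prmOf, Pof, hK]

variable {S : Fin (numSamples (dim n) (lev n) (aggK n - 1) (m₂ n) (reps c n) (trials c n) (meas c n) (extra n)) →
  (Fin (dim n) → ZMod (2 ^ lev n)) × ZMod (2 ^ lev n)} {r bits : List Bool} {LD : LData}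

/-- The caps hold: every unary copy fits in the input length. [folklore] -/
def CapsOK (z : TopIn) : Prop :=
  dim n ≤ (topE z).length ∧ aggK n ≤ (topE z).length ∧ lev n ≤ (topE z).length ∧ m₂ n ≤ (topE z).length ∧
    trials c n ≤ (topE z).length ∧ reps c n ≤ (topE z).length ∧ meas c n ≤ (topE z).length

variable {c m₂ coinsD n}

/-- **The unary copies are the genuine ones** when the caps hold. [folklore] -/
theorem unaryOf_eq {z : TopIn} (hz : z.1.1.1 = n) (h : CapsOK c m₂ n z) :
    unaryOf c m₂ coinsD z = Uof7 (dim n) (lev n) (aggK n - 1) (m₂ n) (reps c n) (trials c n) (meas c n) := by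
  obtain ⟨h1, h2, h3, h4, h5, h6, h7⟩ := h
  have hK : aggK n - 1 + 1 = aggK n := Nat.sub_add_cancel (one_le_aggK n)
  simp only [unaryOf, hz, prmOf_eq_Pof, Pof, PrmT.d, PrmT.K, PrmT.e, PrmT.m, PrmT.T, PrmT.N, PrmT.N', ucap, Uof7, hK,
    Nat.min_eq_left h1, Nat.min_eq_left h2, Nat.min_eq_left h3, Nat.min_eq_left h4, Nat.min_eq_left h5, Nat.min_eq_left h6,
    Nat.min_eq_left h7]

/-- The code of the genuine round input. [folklore] -/
theorem topE_genuine (S' : Fin (numSamples (dim n) (lev n) (aggK n - 1) (m₂ n) (reps c n) (trials c n) (meas c n) (extra n)) →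
    (Fin (dim n) → ZMod (2 ^ lev n)) × ZMod (2 ^ lev n)) (r' bits' : List Bool) :
    topE (((n, toLData S'), r'), bits') = boolPair (boolPair (tagged n S') r') bits' := by
  simp only [pairE_apply, tagged, strE, ldataE_toLData]
  rfl

/-- **The query function on a genuine input** of round `|answers| < nCalls`. [cite: MicciancioPeikert2012, Thm. 3.1 proof (pp. 15–16)] -/
theorem topQ_eq (hn : 1 ≤ n) (hr : numCoins (dim n) (lev n) (m₂ n) (reps c n) (trials c n) (meas c n) (ellOf m₂ coinsD n) ≤ r.length)
    (hcap : CapsOK c m₂ n (((n, toLData S), r), bits))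
    (hbits : bits.length < nCalls (dim n) (lev n) 2 (trials c n) (reps c n) (meas c n)) :
    let inp := layout (dim n) (lev n) (aggK n - 1) (m₂ n) (reps c n) (trials c n) (meas c n) (extra n) (ellOf m₂ coinsD n)
      (S, coinsOf (dim n) (lev n) (m₂ n) (reps c n) (trials c n) (meas c n) (ellOf m₂ coinsD n) r)
    let q := queryOf (K' := aggK n - 1) (1 / (invGap c n : ℝ)) inp bits bits.length
    topQ c m₂ coinsD (((n, toLData S), r), bits) = ((n, toLData q.1), (List.ofFn q.2).take (coinsD.eval (tagged n q.1).length)) := by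
  intro inp q
  have hG : 1 ≤ invGap c n := invGap_pos hn
  have hQL := queryOfL_eq (m' := extra n) (G := invGap c n) (S := S) (ℓ := ellOf m₂ coinsD n) hr hG hbits
  have hU := unaryOf_eq (coinsD := coinsD) (z := (((n, toLData S), r), bits)) rfl hcap
  simp only [topQ, hU, prmOf_eq_Pof]
  rw [show ((Pof (dim n) (lev n) (aggK n - 1) (m₂ n) (reps c n) (trials c n) (meas c n) (extra n) (ellOf m₂ coinsD n) (invGap c n),
      Uof7 (dim n) (lev n) (aggK n - 1) (m₂ n) (reps c n) (trials c n) (meas c n)), ((toLData S).2.2, (r, bits))) =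
      qCtxOf (ℓ := ellOf m₂ coinsD n) (G := invGap c n) S r bits from rfl, hQL]
  simp only [List.length_ofFn]
  have hlen : (pairE unE ldataE (n, toLData q.1)).length = (tagged n q.1).length := by
    rw [pairE_apply, ldataE_toLData, tagged]
  rw [hlen]
  refine Prod.ext rfl (List.take_eq_take_iff.2 ?_)
  simp

/-- **The output function on a genuine input.** [cite: MicciancioPeikert2012, Thm. 3.1 proof (p. 16)] -/
theorem topG_eq (hn : 1 ≤ n) (hcap : CapsOK c m₂ n (((n, toLData S), r), bits)) :
    topG c m₂ coinsD (((n, toLData S), r), bits) =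
      (List.ofFn fun cc => (outOf (K' := aggK n - 1) (1 / (invGap c n : ℝ)) (fun a => topSolve (m' := extra n) (d := dim n) (lev n) a)
        (layout (dim n) (lev n) (aggK n - 1) (m₂ n) (reps c n) (trials c n) (meas c n) (extra n) (ellOf m₂ coinsD n)
          (S, coinsOf (dim n) (lev n) (m₂ n) (reps c n) (trials c n) (meas c n) (ellOf m₂ coinsD n) r)) bits cc).val, []) := by
  have hG : 1 ≤ invGap c n := invGap_pos hn
  have hU := unaryOf_eq (coinsD := coinsD) (z := (((n, toLData S), r), bits)) rfl hcap
  have hO := outOfL_eq (K' := aggK n - 1) (m := m₂ n) (N := reps c n) (T := trials c n) (N' := meas c n) (m' := extra n) (ℓ := ellOf m₂ coinsD n)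
    (G := invGap c n) (S := S) (coins := coinsOf (dim n) (lev n) (m₂ n) (reps c n) (trials c n) (meas c n) (ellOf m₂ coinsD n) r) (bits := bits) hG
  simp only [topG, hU, prmOf_eq_Pof]
  exact hO

/-- **The output code is the code of the secret** (an identity of the tree's `pairE`/`encodeSecret`). [folklore] -/
theorem pairE_secret_eq {d Q : ℕ} (v : Fin d → ZMod Q) : pairE (listE natE) strE (List.ofFn (fun cc => (v cc).val), []) = encodeSecret v := by
  rw [encodeSecret, encodingFinVec_encode_eq, pairE_apply]
  simp only [listE, List.length_ofFn, unE_eq_ones, rawE, List.map_ofFn, strE]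
  rfl

end Genuine

end Prog

end MP12

end LWE

end Literature.Computability.Cryptography

end

/-!
# The Micciancio–Peikert machine, IX: the run of the adaptive machine against the simulated distinguisher

Topic `Computability/Cryptography` (LWE), grouping namespace `LWE.MP12.Machine`. Proved material (no
named fact) towards `Literature.Computability.Cryptography.blprs_gapSVP_sqrt_dim_to_lwe_classical`
(**pqc.S21**), hypothesis `h₂`: the adaptive oracle machine `adFnAlg topQS q topGS`
(`Complexity/AdaptiveFunctions.lean`) run with the oracle that answers a query `⟨u, coins⟩` by the
distinguisher's deterministic decision (`OracleAlg.randAnswer` of `D.mapOut encode`, a language oracle,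
`simOracle_eq_ofLanguage`) on a genuine input `⟨⟨1ⁿ, samples⟩, coins⟩`:
* `query_bit` — the answer bit of a round is the kernel sample `kernelSample D O …` of the strategy's
  query of that round;
* `adBits_eq_closedLoop` — the answer bits are the closed loop of the strategy;
* `outOf_congr` — the output only reads the first `nCalls` answer bits;
* **`run_machine`** — the machine outputs the code of `solveDet … (layout (S, coins))`, the
  deterministic solver of the analysis.

## References

* D. Micciancio, C. Peikert, *Trapdoors for lattices: simpler, tighter, faster, smaller*, EUROCRYPT 2012,
  LNCS 7237; full version IACR ePrint 2011/501, §3, Thm. 3.1 proof (pp. 15–16). [MicciancioPeikert2012]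
* R. E. Ladner, N. A. Lynch, A. L. Selman, *A comparison of polynomial time reducibilities*, TCS 1 (1975), §2. [LadnerLynchSelman1975]
-/

noncomputable section

namespace Literature.Computability.Cryptography

namespace LWE

namespace MP12

namespace Machine

open _root_.Computability Polynomial Literature.Computability.Complexity Literature.Computability.Complexity.CodeFP
  Literature.Computability.Complexity.AdQuery OracleAlg Prog BLPRS2013

/-! ### The simulated distinguisher as a language oracle -/

section Sim

variable (D : OracleAlg Bool) (fuelD : Polynomial ℕ) (O : Oracle)

/-- **The simulated oracle**: `⟨u, coins⟩ ↦ [D's decision]` (default `0` on a time-out). [cite: AroraBarak2009, §3.4 with Def. 7.1] -/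
def simOracle : Oracle := randAnswer (D.mapOut encodingBoolBool.encode) fuelD [false] O

/-- Its language. [folklore] -/
def simLang : Language Bool := {w | simOracle D fuelD O w = [true]}

/-- The decision bit of `D` on `w` (read with `fuelD` at the length of the first field). [folklore] -/
def simBit (w : List Bool) : Bool := (D.run O (fuelD.eval (boolUnpair w).1.length) w).getD false

/-- The run of `D.mapOut encode`. [folklore] -/
theorem run_mapOut_encode (k : ℕ) (w : List Bool) :
    (D.mapOut encodingBoolBool.encode).run O k w = (D.run O k w).map encodingBoolBool.encode := by
  show (D.mapOut _).runAux O w k [] = (D.runAux O w k []).map _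
  rw [runAux_mapOut]

/-- The simulated oracle answers the one-bit string of the decision bit. [folklore] -/
theorem simOracle_apply (w : List Bool) : simOracle D fuelD O w = [simBit D fuelD O w] := by
  rw [simOracle, randAnswer, run_mapOut_encode, simBit]
  cases D.run O (fuelD.eval (boolUnpair w).1.length) w <;> rfl

/-- **The simulated oracle is the oracle of its language.** [folklore] -/
theorem simOracle_eq_ofLanguage : simOracle D fuelD O = Oracle.ofLanguage (simLang D fuelD O) := by
  funext w
  rw [show Oracle.ofLanguage (simLang D fuelD O) w = [(simLang D fuelD O).boolIndicator w] from rfl, simOracle_apply]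
  congr 1
  have hmem : w ∈ simLang D fuelD O ↔ simBit D fuelD O w = true := by
    show simOracle D fuelD O w = [true] ↔ _
    rw [simOracle_apply]
    simp
  by_cases h : simBit D fuelD O w = true
  · rw [h]; exact ((Set.mem_iff_boolIndicator _ _).1 (hmem.2 h)).symm
  · have hnot : w ∉ simLang D fuelD O := fun hw => h (hmem.1 hw)
    rw [Bool.eq_false_iff.2 h]
    exact (Set.notMem_iff_boolIndicator _ _ |>.1 hnot).symm

/-- The indicator of the language on a pair `⟨u, coins⟩`. [folklore] -/
theorem boolIndicator_simLang_boolPair (u cs : List Bool) :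
    (simLang D fuelD O).boolIndicator (boolPair u cs) = (D.run O (fuelD.eval u.length) (boolPair u cs)).getD false := by
  have h := congrFun (simOracle_eq_ofLanguage D fuelD O) (boolPair u cs)
  rw [show Oracle.ofLanguage (simLang D fuelD O) (boolPair u cs) = [(simLang D fuelD O).boolIndicator (boolPair u cs)] from rfl, simOracle_apply,
    List.singleton_inj] at h
  rw [← h, simBit]
  simp

end Sim

/-! ### The run on a genuine input -/

section Run

variable (c : ℕ) {m₂ : ℕ → ℕ} (coinsD fuelD : Polynomial ℕ) (D : OracleAlg Bool) (O : Oracle) (hm₂ : CodeFP unE natE m₂) (n : ℕ)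

/-- The kernel of the analysis: the decision bit of `D` on `⟨⟨1ⁿ, block⟩, coins⟩`. [cite: AroraBarak2009, Def. 7.1] -/
abbrev kern : (Fin (m₂ n) → (Fin (dim n) → ZMod (2 ^ lev n)) × ZMod (2 ^ lev n)) → (Fin (ellOf m₂ coinsD n) → Bool) → Bool :=
  kernelSample D O coinsD fuelD n

variable {S : Fin (numSamples (dim n) (lev n) (aggK n - 1) (m₂ n) (reps c n) (trials c n) (meas c n) (extra n)) →
  (Fin (dim n) → ZMod (2 ^ lev n)) × ZMod (2 ^ lev n)} {r : List Bool}

/-- The layout of the genuine input. [folklore] -/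
abbrev inpOf (S : Fin (numSamples (dim n) (lev n) (aggK n - 1) (m₂ n) (reps c n) (trials c n) (meas c n) (extra n)) →
    (Fin (dim n) → ZMod (2 ^ lev n)) × ZMod (2 ^ lev n)) (r : List Bool) :=
  layout (dim n) (lev n) (aggK n - 1) (m₂ n) (reps c n) (trials c n) (meas c n) (extra n) (ellOf m₂ coinsD n)
    (S, coinsOf (dim n) (lev n) (m₂ n) (reps c n) (trials c n) (meas c n) (ellOf m₂ coinsD n) r)

/-- The caps as bounds on the coin string. [folklore] -/
def CapsLE (r : List Bool) : Prop :=
  dim n ≤ r.length ∧ aggK n ≤ r.length ∧ lev n ≤ r.length ∧ m₂ n ≤ r.length ∧ trials c n ≤ r.length ∧ reps c n ≤ r.length ∧ meas c n ≤ r.length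

variable {c coinsD fuelD D O n}

/-- Caps on the coin string give the caps on every round input. [folklore] -/
theorem capsOK_of_capsLE (h : CapsLE c n (m₂ := m₂) r) (bits : List Bool) : CapsOK c m₂ n (((n, toLData S), r), bits) := by
  have hlen : r.length ≤ (topE (((n, toLData S), r), bits)).length := by
    rw [topE_genuine, length_boolPair, length_boolPair]; omega
  obtain ⟨h1, h2, h3, h4, h5, h6, h7⟩ := h
  exact ⟨h1.trans hlen, h2.trans hlen, h3.trans hlen, h4.trans hlen, h5.trans hlen, h6.trans hlen, h7.trans hlen⟩

/-- **The answer bit of a round is the kernel sample of the strategy's query.** [cite: MicciancioPeikert2012, Thm. 3.1 proof (pp. 15–16)] -/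
theorem query_bit (hn : 1 ≤ n) (hr : numCoins (dim n) (lev n) (m₂ n) (reps c n) (trials c n) (meas c n) (ellOf m₂ coinsD n) ≤ r.length)
    (hcap : CapsLE c n (m₂ := m₂) r) {bits : List Bool} (hbits : bits.length < nCalls (dim n) (lev n) 2 (trials c n) (reps c n) (meas c n)) :
    (simLang D fuelD O).boolIndicator (topQS c coinsD hm₂ (topE (((n, toLData S), r), bits))) =
      kern coinsD fuelD D O n (queryOf (K' := aggK n - 1) (1 / (invGap c n : ℝ)) (inpOf c coinsD n S r) bits bits.length).1
        (queryOf (K' := aggK n - 1) (1 / (invGap c n : ℝ)) (inpOf c coinsD n S r) bits bits.length).2 := by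
  rw [topQS_apply, topQ_eq hn hr (capsOK_of_capsLE hcap bits) hbits]
  rw [pairE_apply, show pairE unE ldataE (n, toLData (queryOf (K' := aggK n - 1) (1 / (invGap c n : ℝ)) (inpOf c coinsD n S r) bits bits.length).1) =
    tagged n (queryOf (K' := aggK n - 1) (1 / (invGap c n : ℝ)) (inpOf c coinsD n S r) bits bits.length).1 from by rw [pairE_apply, ldataE_toLData, tagged],
    boolIndicator_simLang_boolPair]
  rfl

/-- The closed loop has `i` bits after `i` rounds. [folklore] -/
theorem length_closedLoop {d p e K' m N T N' m' : ℕ} {C : Type} [Inhabited C] (γ : ℝ) (f : (Fin m → (Fin d → ZMod (p ^ e)) × ZMod (p ^ e)) → C → Bool)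
    (inp : Input d p e K' m N T N' m' C) : ∀ i, (closedLoop γ f inp i).length = i
  | 0 => rfl
  | i + 1 => by rw [closedLoop, List.length_append, length_closedLoop γ f inp i]; rfl

/-- **The answer bits are the closed loop of the strategy.** [cite: LadnerLynchSelman1975, §2] -/
theorem adBits_eq_closedLoop (hn : 1 ≤ n) (hr : numCoins (dim n) (lev n) (m₂ n) (reps c n) (trials c n) (meas c n) (ellOf m₂ coinsD n) ≤ r.length)
    (hcap : CapsLE c n (m₂ := m₂) r) :
    ∀ i ≤ nCalls (dim n) (lev n) 2 (trials c n) (reps c n) (meas c n),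
      adBits (topQS c coinsD hm₂) (simLang D fuelD O) (boolPair (tagged n S) r) i =
        closedLoop (1 / (invGap c n : ℝ)) (kern coinsD fuelD D O n) (inpOf c coinsD n S r) i
  | 0, _ => rfl
  | i + 1, hi => by
    have ih := adBits_eq_closedLoop hn hr hcap i (Nat.le_of_succ_le hi)
    rw [adBits_succ, closedLoop, ih, ← topE_genuine, query_bit hm₂ hn hr hcap (by rw [length_closedLoop]; exact hi), length_closedLoop]

/-! ### The output reads only the first `nCalls` bits -/

section Congr

variable {d p e K' m N T N' m' : ℕ} {C : Type} (γ : ℝ)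
  (F : ℕ → (Fin m' → (Fin d → ZMod (p ^ e)) × ZMod (p ^ e)) → (Fin m' → ZMod (p ^ e)) → (Fin d → ZMod (p ^ e)))
  {h₁ h₂ : List Bool} (h : ∀ i < nCalls d e p T N N', bitAt h₁ i = bitAt h₂ i)
include h

/-- The estimation bits agree. [folklore] -/
theorem estBits_congr : estBits (e := e) (N' := N') h₁ = estBits (e := e) (N' := N') h₂ := by
  funext j k
  exact h _ (lt_of_lt_of_le (finProdFinEquiv (j, k)).2 (Nat.le_add_right _ _))

/-- The digit bits agree. [folklore] -/
theorem digBit_congr (x : DigIdx d e p T N) : digBit (e := e) (N' := N') h₁ x = digBit (e := e) (N' := N') h₂ x :=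
  h _ (Nat.add_lt_add_left ((digEquiv d e p T N) x).2 _)

/-- The verdicts agree. [folklore] -/
theorem stepVerd_congr (c' : Fin d) (i' : Fin e) :
    stepVerd (p := p) (N := N) (T := T) (N' := N') γ h₁ c' i' = stepVerd (p := p) (N := N) (T := T) (N' := N') γ h₂ c' i' := by
  funext k
  simp only [stepVerd]
  rw [decide_eq_decide]
  simp only [digBit_congr h]

/-- The loop states agree. [folklore] -/
theorem Lstate_congr (c' : Fin d) : ∀ i, Lstate (p := p) (e := e) (N := N) (T := T) (N' := N') γ h₁ c' i = Lstate (p := p) (e := e) (N := N) (T := T) (N' := N') γ h₂ c' i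
  | 0 => rfl
  | i + 1 => by
    rw [Lstate, Lstate, Lstate_congr c' i]
    split_ifs with hi
    · rw [stepVerd_congr γ h]
    · rfl

/-- **The output reads only the first `nCalls` answer bits.** [folklore] -/
theorem outOf_congr (inp : Input d p e K' m N T N' m' C) : outOf γ F inp h₁ = outOf γ F inp h₂ := by
  unfold outOf stepOf
  rw [estBits_congr h]
  simp only [Lstate_congr γ h]

end Congr

/-- Earlier answer bits are a prefix of later ones. [folklore] -/
theorem adBits_prefix (Q : List Bool → List Bool) (A : Language Bool) (x : List Bool) {i k : ℕ} (hik : i ≤ k) :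
    adBits Q A x i <+: adBits Q A x k := by
  induction k with
  | zero => rw [Nat.le_zero.1 hik]
  | succ k ih =>
    rcases Nat.lt_succ_iff_lt_or_eq.1 (Nat.lt_succ_of_le hik) with hlt | rfl
    · exact (ih (Nat.lt_succ_iff.1 hlt)).trans ⟨_, (adBits_succ A x k).symm⟩
    · exact List.prefix_rfl

/-- A prefix has the same bits. [folklore] -/
theorem bitAt_eq_of_prefix {l₁ l₂ : List Bool} (h : l₁ <+: l₂) {i : ℕ} (hi : i < l₁.length) : bitAt l₂ i = bitAt l₁ i := by
  obtain ⟨t, rfl⟩ := h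
  rw [bitAt, bitAt, List.getD_eq_getElem _ _ (by simp; omega), List.getD_eq_getElem _ _ hi, List.getElem_append_left hi]

/-- **The run of the machine on a genuine input**: the code of the deterministic solver's output.
[cite: MicciancioPeikert2012, Thm. 3.1 proof (pp. 15–16)] -/
theorem run_machine (hn : 1 ≤ n) (hr : numCoins (dim n) (lev n) (m₂ n) (reps c n) (trials c n) (meas c n) (ellOf m₂ coinsD n) ≤ r.length)
    (hcap : CapsLE c n (m₂ := m₂) r) (qR : Polynomial ℕ) (hq : nCalls (dim n) (lev n) 2 (trials c n) (reps c n) (meas c n) ≤ qR.eval (boolPair (tagged n S) r).length)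
    {budget : ℕ} (hb : qR.eval (boolPair (tagged n S) r).length < budget) :
    (adFnAlg (topQS c coinsD hm₂) qR (topGS c coinsD hm₂)).run (simOracle D fuelD O) budget (boolPair (tagged n S) r) =
      some (encodeSecret (solveDet (aggK n - 1) (m₂ n) (reps c n) (trials c n) (meas c n) (extra n) (1 / (invGap c n : ℝ))
        (kern coinsD fuelD D O n) (fun a => topSolve (lev n) a) (inpOf c coinsD n S r))) := by
  haveI : NeZero (2 ^ lev n) := ⟨(Nat.two_pow_pos _).ne'⟩
  rw [simOracle_eq_ofLanguage, run_adFnAlg _ _ hb, adFn_apply]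
  set K := qR.eval (boolPair (tagged n S) r).length with hK
  rw [← topE_genuine, topGS_apply, topG_eq hn (capsOK_of_capsLE hcap _), pairE_secret_eq, ← outOf_closedLoop]
  congr 2
  refine outOf_congr _ _ (fun i hi => ?_) _
  have hpre := adBits_prefix (topQS c coinsD hm₂) (simLang D fuelD O) (boolPair (tagged n S) r) (hq.trans_eq hK.symm)
  rw [bitAt_eq_of_prefix hpre (by rw [length_adBits]; exact hi), adBits_eq_closedLoop hm₂ hn hr hcap _ le_rfl]

end Run

end Machine

end MP12

end LWE

end Literature.Computability.Cryptography

end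

/-!
# The Micciancio–Peikert machine, X: decision `LWE_{d,2ᵉ,Ψ̄_{α₂}}` to search `LWE_{d,2ᵉ,Ψ̄_{α₁}}` as ONE oracle machine (hypothesis `h₂` of pqc.S21)

Topic `Computability/Cryptography` (LWE), grouping namespace `LWE.MP12.Machine`. Proved material (no
named fact) towards `Literature.Computability.Cryptography.blprs_gapSVP_sqrt_dim_to_lwe_classical`
(**pqc.S21**): the transformer form of BLPRS Thm. 2.17 = Micciancio–Peikert Thm. 3.1 on the schedule of
`BLPRSReduction.lean`, i.e. EXACTLY hypothesis `h₂` of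
`BLPRS2013.blprs_gapSVP_sqrt_dim_to_lwe_classical_of_components`:
**`mp12_decision_to_search`** — from a polynomial-time distinguisher `D` of
`LWE_{dim n, 2^{lev n}, Ψ̄_{rate₂}}` with advantage `≥ 1/nᶜ` (relative to any oracle `O`), ONE
polynomial-time oracle machine `R` (the adaptive machine of the `Machine` part of this file composed
with the clocked randomised subroutine `D`, `OracleAlg.exists_polyTime_randSubroutine`) solving search
`LWE_{dim n, 2^{lev n}, Ψ̄_{rate₁}}` with average-case probability `≥ 2/3`, eventually in `n`: its
success probability at every secret is the ideal law's (`law_layout`, `law_solveDet`,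
`uniform_map_kernelSample`), which fails with probability `≤ 7/24` (`eventually_idealLaw_ne_le`).

## References

* D. Micciancio, C. Peikert, *Trapdoors for lattices: simpler, tighter, faster, smaller*, EUROCRYPT 2012,
  LNCS 7237; full version IACR ePrint 2011/501, §3, Thm. 3.1. [MicciancioPeikert2012]
* Z. Brakerski, A. Langlois, C. Peikert, O. Regev, D. Stehlé, *Classical hardness of learning with
  errors*, STOC 2013, Thm. 2.17 (citing MP12 Thm. 3.1). [BrakerskiEtAl2013]
* S. Arora, B. Barak, *Computational Complexity: A Modern Approach*, CUP 2009, §3.4, Def. 7.1. [AroraBarak2009]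
-/

noncomputable section

namespace Literature.Computability.Cryptography

namespace LWE

namespace MP12

namespace Machine

open _root_.Computability Polynomial Filter Literature.Computability.Complexity Literature.Computability.Complexity.CodeFP
  Literature.Computability.Complexity.AdQuery OracleAlg Prog BLPRS2013
open scoped ENNReal
open Literature.Probability.Distributions

/-! ### Generic lemmas -/

section Generic

open scoped Classical in
/-- The mass at a point is one minus the outer measure of its complement. [folklore] -/
theorem pmf_apply_add_toOuterMeasure_ne {α : Type} (P : PMF α) (a : α) : P a + P.toOuterMeasure {x | x ≠ a} = 1 := by
  have h1 : P.toOuterMeasure {x | x ≠ a} = ∑' x, ite (x = a) 0 (P x) := by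
    rw [PMF.toOuterMeasure_apply]
    refine tsum_congr fun x => ?_
    by_cases hx : x = a
    · subst hx; simp
    · simp [hx]
  rw [h1, ← ENNReal.tsum_eq_add_tsum_ite (f := (⇑P)) a, P.tsum_coe]

/-- If the complement has outer measure `≤ 7/24` then the point has mass `≥ 2/3`. [folklore] -/
theorem two_thirds_le_of_compl_le {α : Type} (P : PMF α) (a : α) (h : P.toOuterMeasure {x | x ≠ a} ≤ ENNReal.ofReal (7 / 24)) :
    ENNReal.ofReal (2 / 3) ≤ P a := by
  have h1 := pmf_apply_add_toOuterMeasure_ne P a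
  have hne : P.toOuterMeasure {x | x ≠ a} ≠ ⊤ := ne_top_of_le_ne_top ENNReal.ofReal_ne_top h
  have h2 : P a = 1 - P.toOuterMeasure {x | x ≠ a} := (ENNReal.eq_sub_of_add_eq hne h1)
  rw [h2]
  calc ENNReal.ofReal (2 / 3) ≤ ENNReal.ofReal (1 - 7 / 24) := ENNReal.ofReal_le_ofReal (by norm_num)
    _ = 1 - ENNReal.ofReal (7 / 24) := by rw [ENNReal.ofReal_sub _ (by norm_num), ENNReal.ofReal_one]
    _ ≤ 1 - P.toOuterMeasure {x | x ≠ a} := tsub_le_tsub_left h 1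

end Generic

/-! ### The sample count -/

section Count

variable (c : ℕ) (m₂ : ℕ → ℕ)

/-- **The sample count of the machine** `m₁ n = numSamples (dim n) (lev n) (aggK n - 1) (m₂ n) (reps c n) (trials c n) (meas c n) (extra n)`.
[cite: MicciancioPeikert2012, Thm. 3.1 proof (pp. 15–16)] -/
abbrev mOne (n : ℕ) : ℕ := numSamples (dim n) (lev n) (aggK n - 1) (m₂ n) (reps c n) (trials c n) (meas c n) (extra n)

/-- The sample count from the parameter tuple. [folklore] -/
def numSamplesL (P : PrmT) : ℕ :=
  (P.e + 1) * (P.N' * (P.m * P.K)) + (P.d * (P.e * (2 * (P.T * (P.N * (P.m * P.K))))) + (P.d * (P.e * (2 * (P.T * (P.N * (P.m * P.K))))) + P.m'))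

/-- `numSamplesL` on codes. [cite: AroraBarak2009, §1.3] -/
theorem codeFP_numSamplesL : CodeFP prmE natE numSamplesL := by
  have hmK := natMul.comp (codeFP_prm_m.pair codeFP_prm_K)
  have hX := natMul.comp (codeFP_prm_d.pair (natMul.comp (codeFP_prm_e.pair (natMul.comp ((const _ 2).pair (natMul.comp (codeFP_prm_T.pair (natMul.comp
    (codeFP_prm_N.pair hmK)))))))))
  exact (natAdd.comp ((natMul.comp ((natAdd.comp (codeFP_prm_e.pair (const _ 1))).pair (natMul.comp (codeFP_prm_N'.pair hmK)))).pair
    (natAdd.comp (hX.pair (natAdd.comp (hX.pair codeFP_prm_m')))))).congr fun P => rfl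

variable {m₂}

/-- **The sample count is polynomial-time computable from `1ⁿ`.** [cite: AroraBarak2009, §1.3] -/
theorem polyTime_mOne (coinsD : Polynomial ℕ) (hm₂ : CodeFP unE natE m₂) : PolyTimeComputable unaryEncodeNat encodeNat (mOne c m₂) := by
  have h : CodeFP unE natE (fun n => numSamplesL (prmOf c m₂ coinsD n)) := codeFP_numSamplesL.comp (codeFP_prmOf c coinsD hm₂)
  refine (h.congr fun n => ?_).polyTimeComputable
  rw [prmOf_eq_Pof]
  rfl

end Count

/-! ### The theorem -/

section Final

variable {q : ℕ → ℕ} {α : ℕ → ℝ}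

/-- The tagged code is long: `n ≤ |⟨1ⁿ, code⟩|`. [folklore] -/
theorem le_length_tagged (n : ℕ) {d Q m : ℕ} (u : Fin m → (Fin d → ZMod Q) × ZMod Q) : n ≤ (tagged n u).length := by
  rw [tagged, length_boolPair]
  have : (unaryEncodeNat n).length = n := length_unE n
  omega

/-- The tagged code is short: `|⟨1ⁿ, code⟩| ≤ 2n + 2 + ldataBound`. [folklore] -/
theorem length_tagged_le (n : ℕ) {d Q m : ℕ} [NeZero Q] (u : Fin m → (Fin d → ZMod Q) × ZMod Q) :
    (tagged n u).length ≤ 2 * n + 2 + ldataBound d Q m := by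
  rw [tagged, length_boolPair]
  have h1 : (unaryEncodeNat n).length = n := length_unE n
  have h2 := length_encodeLWESamples_le_ldataBound u
  omega

/-- **Micciancio–Peikert Thm. 3.1 / BLPRS Thm. 2.17 as ONE oracle machine** (hypothesis `h₂` of
`blprs_gapSVP_sqrt_dim_to_lwe_classical_of_components`). [cite: MicciancioPeikert2012, Thm. 3.1; BrakerskiEtAl2013, Thm. 2.17] -/
theorem mp12_decision_to_search (q m : ℕ → ℕ) :
    ∀ (α : ℕ → ℝ) (_ : IsPolyBounded q) (_ : IsPolyBounded m) (_ : IsPolyTimeParams q α m)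
      (_ : ∀ᶠ n : ℕ in atTop, 0 < α n ∧ α n < 1 ∧ Real.sqrt n * Real.log n ≤ α n * q n)
      (D : OracleAlg Bool) (coinsD fuelD : Polynomial ℕ) (m₂ : ℕ → ℕ) (c : ℕ),
      D.IsPolyTime encodingBoolBool → IsPolyBounded m₂ → PolyTimeComputable unaryEncodeNat encodeNat m₂ →
      ∃ (R : OracleAlg (List Bool)) (coinsR fuelR : Polynomial ℕ) (m₁ : ℕ → ℕ),
        R.IsPolyTime (encodingList Bool) ∧ IsPolyBounded m₁ ∧ PolyTimeComputable unaryEncodeNat encodeNat m₁ ∧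
        ∀ O : Oracle, DistinguishesSmallDim α D O coinsD fuelD m₂ c → SolvesSmallDimSearch α R O coinsR fuelR m₁ := by
  intro α hq _hm _hp hα D coinsD fuelD m₂ c hD hm₂b hm₂pt
  have hm₂ : CodeFP unE natE m₂ := codeFP_natParam hm₂pt
  -- the polynomials
  obtain ⟨pN, hpN⟩ := isPolyBounded_nCalls c
  obtain ⟨pC, hpC⟩ := isPolyBounded_add (isPolyBounded_numCoins c coinsD hm₂b) (isPolyBounded_add (isPolyBounded_add (isPolyBounded_add
    (isPolyBounded_add (isPolyBounded_add (isPolyBounded_add isPolyBounded_dim isPolyBounded_aggK) isPolyBounded_lev) hm₂b) (isPolyBounded_trials c))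
      (isPolyBounded_reps c)) (isPolyBounded_meas c))
  obtain ⟨s, hs⟩ := exists_poly_length_le_of_mem_FP (topQS_mem_FP c coinsD hm₂)
  set qR : Polynomial ℕ := pN with hqR
  set qM : Polynomial ℕ := qR + 1 + s.comp (2 * X + 2 + qR) with hqM
  -- the machines
  have hM : (adFnAlg (topQS c coinsD hm₂) qR (topGS c coinsD hm₂)).IsPolyTime (encodingList Bool) :=
    isPolyTime_adFnAlg (topQS_mem_FP c coinsD hm₂) (topGS_mem_FP c coinsD hm₂)
  have hDlP : (D.mapOut encodingBoolBool.encode).IsPolyTime (encodingList Bool) := hD.mapOut _ fun _ => rfl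
  obtain ⟨C, hC, qC, hspec⟩ := exists_polyTime_randSubroutine hM hDlP qM fuelD [false]
  refine ⟨C, pC, qC.comp (2 * X + 2 + pC), mOne c m₂, hC, isPolyBounded_numSamples c hm₂b, polyTime_mOne c coinsD hm₂, fun O hDist => ?_⟩
  -- the run of `C` on a genuine input
  have hrun : ∀ (n : ℕ), 1 ≤ n → ∀ (S : Fin (mOne c m₂ n) → (Fin (dim n) → ZMod (2 ^ lev n)) × ZMod (2 ^ lev n)) (r : List Bool),
      r.length = pC.eval (tagged n S).length →
      C.run O (qC.eval (boolPair (tagged n S) r).length) (boolPair (tagged n S) r) =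
        some (encodeSecret (solveDet (aggK n - 1) (m₂ n) (reps c n) (trials c n) (meas c n) (extra n) (1 / (invGap c n : ℝ))
          (kern coinsD fuelD D O n) (fun a => topSolve (lev n) a) (inpOf c coinsD n S r))) := by
    intro n hn S r hrlen
    have hnle : n ≤ (tagged n S).length := le_length_tagged n S
    have hpCle : pC.eval n ≤ r.length := hrlen ▸ TM2Iter.eval_mono pC hnle
    have hb := hpC n
    simp only [ellOf] at hb ⊢
    have hr : numCoins (dim n) (lev n) (m₂ n) (reps c n) (trials c n) (meas c n) (coinsD.eval (2 * n + 2 + ldataBound (dim n) (2 ^ lev n) (m₂ n))) ≤ r.length := by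
      omega
    have hcap : CapsLE c n (m₂ := m₂) r := by unfold CapsLE; omega
    have hxlen : n ≤ (boolPair (tagged n S) r).length := by rw [length_boolPair]; omega
    have hq' : nCalls (dim n) (lev n) 2 (trials c n) (reps c n) (meas c n) ≤ qR.eval (boolPair (tagged n S) r).length :=
      (hpN n).trans (TM2Iter.eval_mono pN hxlen)
    have hbud : qR.eval (boolPair (tagged n S) r).length < qM.eval (boolPair (tagged n S) r).length := by rw [hqM]; simp; omega
    have hMrun := run_machine (c := c) (coinsD := coinsD) (fuelD := fuelD) (D := D) (O := O) hm₂ (S := S) hn hr hcap qR hq' hbud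
    refine (hspec O (boolPair (tagged n S) r) _ hMrun ?_).1
    intro y hy
    have hy' : y ∈ (adFnAlg (topQS c coinsD hm₂) qR (topGS c coinsD hm₂)).queries (Oracle.ofLanguage (simLang D fuelD O))
        (qM.eval (boolPair (tagged n S) r).length) (boolPair (tagged n S) r) := by
      rw [← simOracle_eq_ofLanguage]; exact hy
    refine (length_le_of_mem_queries_adFnAlg hs _ _ hy').trans ?_
    rw [hqM]
    simp [eval_comp]
  -- eventually in `n`
  have hideal := eventually_idealLaw_ne_le c (q := q) (m := m₂) (α := α) hq hm₂b hα
  rw [SolvesSmallDimSearch]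
  rw [DistinguishesSmallDim] at hDist
  filter_upwards [hideal, hDist, eventually_ge_atTop 1] with n hI hadv hn1
  -- the solver as a uniform map of the deterministic solver (`modulus n = 2 ^ lev n` definitionally)
  change ENNReal.ofReal (2 / 3) ≤ searchSuccessProb (discretizedGaussian (2 ^ lev n) (rate₁ α n)) (mOne c m₂ n)
    (taggedSearchSolver C O pC (qC.comp (2 * X + 2 + pC)) n (dim n) (2 ^ lev n) (mOne c m₂ n))
  haveI : NeZero (2 ^ lev n) := ⟨(Nat.two_pow_pos _).ne'⟩
  haveI : Fact (Nat.Prime 2) := ⟨Nat.prime_two⟩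
  obtain ⟨G, hG⟩ : ∃ G : (Fin (mOne c m₂ n) → (Fin (dim n) → ZMod (2 ^ lev n)) × ZMod (2 ^ lev n)) → (Fin (numCoins (dim n) (lev n) (m₂ n) (reps c n) (trials c n) (meas c n) (ellOf m₂ coinsD n)) → Bool) → (Fin (dim n) → ZMod (2 ^ lev n)),
      G = fun S cf => solveDet (aggK n - 1) (m₂ n) (reps c n) (trials c n) (meas c n) (extra n) (1 / (invGap c n : ℝ)) (kern coinsD fuelD D O n)
        (fun a => topSolve (lev n) a) (layout (dim n) (lev n) (aggK n - 1) (m₂ n) (reps c n) (trials c n) (meas c n) (extra n) (ellOf m₂ coinsD n) (S, cf)) :=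
    ⟨_, rfl⟩
  have hLle : ∀ S : Fin (mOne c m₂ n) → (Fin (dim n) → ZMod (2 ^ lev n)) × ZMod (2 ^ lev n), numCoins (dim n) (lev n) (m₂ n) (reps c n) (trials c n) (meas c n) (ellOf m₂ coinsD n) ≤ pC.eval (tagged n S).length := by
    intro S
    have h1 := hpC n
    have h2 := TM2Iter.eval_mono pC (le_length_tagged n S)
    dsimp only at h1
    show numCoins (dim n) (lev n) (m₂ n) (reps c n) (trials c n) (meas c n) (coinsD.eval (2 * n + 2 + ldataBound (dim n) (2 ^ lev n) (m₂ n))) ≤ _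
    omega
  have hsolver := taggedSearchSolver_eq_map C O pC (qC.comp (2 * X + 2 + pC)) n (d := dim n) (Q := 2 ^ lev n) (m := mOne c m₂ n) G hLle
    (fun S r => by
      have hlen : r.toList.length = pC.eval (tagged n S).length := by simp
      have h := hrun n hn1 S r.toList hlen
      have hfuel : (qC.comp (2 * X + 2 + pC)).eval (tagged n S).length = qC.eval (boolPair (tagged n S) r.toList).length := by
        rw [length_boolPair, hlen]; simp [eval_comp]
      rw [hfuel, h, Option.getD_some, decodeSecret_encodeSecret, hG]
      rfl)
  rw [hsolver]
  refine searchSuccessProb_ge_of_forall _ _ _ fun s => ?_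
  -- the law of the output at the secret `s` is the ideal law
  have hK : aggK n - 1 + 1 = aggK n := Nat.sub_add_cancel (one_le_aggK n)
  have hDk : (fun u => (PMF.uniformOfFintype (Fin (ellOf m₂ coinsD n) → Bool)).map (kern coinsD fuelD D O n u)) =
      taggedDistinguisher D O coinsD fuelD n (dim n) (2 ^ lev n) (m₂ n) :=
    funext fun u => uniform_map_kernelSample D O coinsD fuelD n u (TM2Iter.eval_mono coinsD (length_tagged_le n u))
  have hlaw : (lweSamples (discretizedGaussian (2 ^ lev n) (rate₁ α n)) s (mOne c m₂ n)).bind (fun S => (PMF.uniformOfFintype (Fin (numCoins (dim n) (lev n) (m₂ n) (reps c n) (trials c n) (meas c n) (ellOf m₂ coinsD n)) → Bool)).map (G S)) =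
      idealLaw (taggedDistinguisher D O coinsD fuelD n (dim n) (2 ^ lev n) (m₂ n))
        (sumNoise (2 ^ lev n) (discretizedGaussian (2 ^ lev n) (rate₁ α n)) (aggK n)) (discretizedGaussian (2 ^ lev n) (rate₁ α n))
        (reps c n) (trials c n) (meas c n) (extra n) (gap c n) (fun a => topSolve (lev n) a) s := by
    have e1 : (lweSamples (discretizedGaussian (2 ^ lev n) (rate₁ α n)) s (mOne c m₂ n)).bind (fun S => (PMF.uniformOfFintype (Fin (numCoins (dim n) (lev n) (m₂ n) (reps c n) (trials c n) (meas c n) (ellOf m₂ coinsD n)) → Bool)).map (G S)) =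
        (prodLaw (lweSamples (discretizedGaussian (2 ^ lev n) (rate₁ α n)) s (mOne c m₂ n)) (PMF.uniformOfFintype (Fin (numCoins (dim n) (lev n) (m₂ n) (reps c n) (trials c n) (meas c n) (ellOf m₂ coinsD n)) → Bool))).map fun p => G p.1 p.2 :=
      (prodLaw_map_eq_bind_fst _ _ (fun p => G p.1 p.2)).symm
    have e2 : (prodLaw (lweSamples (discretizedGaussian (2 ^ lev n) (rate₁ α n)) s (mOne c m₂ n)) (PMF.uniformOfFintype (Fin (numCoins (dim n) (lev n) (m₂ n) (reps c n) (trials c n) (meas c n) (ellOf m₂ coinsD n)) → Bool))).map (fun p => G p.1 p.2) =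
        ((prodLaw (lweSamples (discretizedGaussian (2 ^ lev n) (rate₁ α n)) s (mOne c m₂ n)) (PMF.uniformOfFintype (Fin (numCoins (dim n) (lev n) (m₂ n) (reps c n) (trials c n) (meas c n) (ellOf m₂ coinsD n)) → Bool))).map
          (layout (dim n) (lev n) (aggK n - 1) (m₂ n) (reps c n) (trials c n) (meas c n) (extra n) (ellOf m₂ coinsD n))).map
          (solveDet (aggK n - 1) (m₂ n) (reps c n) (trials c n) (meas c n) (extra n) (1 / (invGap c n : ℝ)) (kern coinsD fuelD D O n)
            (fun a => topSolve (lev n) a)) := by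
      rw [PMF.map_comp, hG]
      rfl
    rw [e1, e2, law_layout, law_solveDet, hDk, hK]
    rfl
  show ENNReal.ofReal (2 / 3) ≤ ((lweSamples (discretizedGaussian (2 ^ lev n) (rate₁ α n)) s (mOne c m₂ n)).bind fun S =>
    (PMF.uniformOfFintype (Fin (numCoins (dim n) (lev n) (m₂ n) (reps c n) (trials c n) (meas c n) (ellOf m₂ coinsD n)) → Bool)).map (G S)) s
  rw [hlaw]
  exact two_thirds_le_of_compl_le _ _ (hI _ hadv _ (fun a => isTopSolverFR_topSolve (lev_pos n) a) s)

end Final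

end Machine

end MP12

end LWE

end Literature.Computability.Cryptography

end
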